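import Mathlib.Analysis.InnerProductSpace.Projection.Basic
import Literature.NumberTheory.Automorphic.SmoothProjector
import HarnessLib

/-!
# Admissible representations with an invariant positive Hermitian form are completely reducible

Topic `NumberTheory/Automorphic` (generic smooth representation theory, next to `SmoothProjector` and
`AdmissibleFiniteLength`); theorems only (no definition, no named fact). Let `G` be a topological group
having a compact open subgroup, `ρ` an ADMISSIBLE representation of `G` on a complex vector space `V`
(`Representation.IsAdmissible`: smooth, with finite-dimensional fixed vectors under compact open
subgroups), and `⟨·, ·⟩ : V × V → ℂ` a positive definite Hermitian form which is `G`-invariant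
(`⟨ρ(g) v, ρ(g) w⟩ = ⟨v, w⟩`; i.e. `ρ` is unitary = pre-unitary). THEN every subrepresentation `W` has
an invariant complement, namely its orthogonal `W^⊥` (`exists_isCompl_subrepresentation_of_invariant_form`).

Proof (Bernstein–Zelevinsky 1976, 2.1–2.3 / Casselman 1995, Prop. 2.1.?: "an admissible unitary
representation is a direct sum of irreducibles"; Bump 1997, proof of Thm. 4.2.?): `W ∩ W^⊥ = 0` by
definiteness; for `v ∈ V` choose a compact open `K₁` fixing `v`; the finite-dimensional space
`T = W ∩ V^{K₁}` has an orthogonal projection, `v = t + z` with `t ∈ T ⊆ W` and `z ⊥ T`, `z ∈ V^{K₁}`;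
and `z ⊥ W`: for `w ∈ W`, `⟨z, w⟩ = ⟨z, e_{K₁} w⟩` (the averaging projector `e_{K₁}` of `SmoothProjector`
is an average of `ρ(k) w`, `k ∈ K₁`, and `⟨z, ρ(k) w⟩ = ⟨ρ(k)⁻¹ z, w⟩ = ⟨z, w⟩`), while
`e_{K₁} w ∈ W ∩ V^{K₁} = T`.

## References

* I. N. Bernstein, A. V. Zelevinsky, *Representations of the group GL(n, F) where F is a
  non-archimedean local field*, Russian Math. Surveys 31:3 (1976), §2.1–2.3 (admissible and unitary
  representations), 4.1. [BernsteinZelevinskyRMS1976]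
* W. Casselman, *Introduction to the theory of admissible representations of `p`-adic reductive
  groups* (1995), §2.1. [Casselman1995]
-/

noncomputable section

open scoped ComplexConjugate
open Literature.NumberTheory.Automorphic.SmoothProjector

namespace Literature.NumberTheory.Automorphic

variable {G V : Type*} [Group G] [TopologicalSpace G] [IsTopologicalGroup G] [AddCommGroup V] [Module ℂ V]
  (ρ : Representation ℂ G V)

omit [TopologicalSpace G] [IsTopologicalGroup G] in
/-- The average `e_H w` of the orbit of `w` under a compact subgroup lies in every subrepresentation
containing `w`. [cite: BernsteinZelevinskyRMS1976, §2.3] -/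
theorem avg_mem_subrepresentation (H : Subgroup G) (W : Subrepresentation ρ) {w : V} (hw : w ∈ W.toSubmodule) :
    avg ρ H w ∈ W.toSubmodule := by
  classical
  refine Submodule.smul_mem _ _ ?_
  by_cases hfin : (orbitSet ρ H w).Finite
  · rw [finsum_mem_eq_finite_toFinset_sum _ hfin]
    refine Submodule.sum_mem _ fun y hy => ?_
    obtain ⟨h, -, rfl⟩ := mem_orbitSet_iff.1 (hfin.mem_toFinset.1 hy)
    exact W.apply_mem_toSubmodule h hw
  · rw [finsum_mem_eq_zero_of_infinite]
    · exact W.toSubmodule.zero_mem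
    · have h1 : (orbitSet ρ H w ∩ Function.support fun y : V => y) = orbitSet ρ H w \ {0} := by
        ext y; simp [Function.mem_support]
      rw [h1]
      exact Set.Infinite.sdiff hfin (Set.finite_singleton 0)

/-- **Complete reducibility of admissible unitary representations.** Let `ρ` be an admissible
representation of a topological group with a compact open subgroup, and `ip` a `G`-invariant positive
definite Hermitian form on the representation space. Then every subrepresentation `W` has an invariant
complement (its orthogonal). [cite: BernsteinZelevinskyRMS1976, §2.3 and 4.1] -/
theorem exists_isCompl_subrepresentation_of_invariant_form (hρ : ρ.IsAdmissible)
    (hK : ∃ K : Subgroup G, IsOpen (K : Set G) ∧ IsCompact (K : Set G))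
    (ip : V → V → ℂ)
    (h_add_left : ∀ x y z, ip (x + y) z = ip x z + ip y z)
    (h_smul_left : ∀ (c : ℂ) (x y : V), ip (c • x) y = conj c * ip x y)
    (h_conj_symm : ∀ x y, conj (ip y x) = ip x y)
    (h_nonneg : ∀ x, 0 ≤ (ip x x).re)
    (h_definite : ∀ x, ip x x = 0 → x = 0)
    (h_inv : ∀ (g : G) (x y : V), ip (ρ g x) (ρ g y) = ip x y)
    (W : Subrepresentation ρ) :
    ∃ W' : Subrepresentation ρ, IsCompl W.toSubmodule W'.toSubmodule := by
  classical
  -- the positive form as an inner product space structure on `V`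
  let core : InnerProductSpace.Core ℂ V :=
    { inner := ip
      conj_inner_symm := h_conj_symm
      re_inner_nonneg := fun x => by rw [RCLike.re_to_complex]; exact h_nonneg x
      add_left := h_add_left
      smul_left := fun x y c => h_smul_left c x y
      definite := h_definite }
  letI i1 : NormedAddCommGroup V := @InnerProductSpace.Core.toNormedAddCommGroup ℂ V _ _ _ core
  letI i2 : InnerProductSpace ℂ V := InnerProductSpace.ofCore core.toCore
  have hinner : ∀ x y : V, inner ℂ x y = ip x y := fun _ _ => rfl
  -- the orthogonal of a subrepresentation is a subrepresentation (`G` acts by isometries)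
  have hperp : ∀ g, ∀ v ∈ W.toSubmoduleᗮ, ρ g v ∈ W.toSubmoduleᗮ := by
    intro g v hv
    rw [Submodule.mem_orthogonal] at hv ⊢
    intro u hu
    have h1 : ρ g (ρ g⁻¹ u) = u := by
      rw [← Module.End.mul_apply, ← map_mul, mul_inv_cancel, map_one, Module.End.one_apply]
    rw [hinner, ← h1, h_inv]
    exact hv _ (W.apply_mem_toSubmodule g⁻¹ hu)
  refine ⟨⟨W.toSubmoduleᗮ, hperp⟩, ?_⟩
  change IsCompl W.toSubmodule W.toSubmoduleᗮ
  refine ⟨Submodule.orthogonal_disjoint _, codisjoint_iff_le_sup.2 fun v _ => ?_⟩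
  -- a compact open subgroup fixing `v`, and the finite-dimensional `T = W ∩ V^{K₁}`
  obtain ⟨K, hKo, hKc⟩ := hK
  set K₁ : Subgroup G := K ⊓ ρ.stabilizerSubgroup v with hK₁
  have hK₁o : IsOpen (K₁ : Set G) := by
    rw [hK₁, Subgroup.coe_inf]; exact hKo.inter (hρ.isSmooth v)
  have hK₁c : IsCompact (K₁ : Set G) := by
    rw [hK₁, Subgroup.coe_inf]
    exact hKc.inter_right ((ρ.stabilizerSubgroup v).isClosed_of_isOpen (hρ.isSmooth v))
  haveI hfin : Module.Finite ℂ (ρ.fixedPoints K₁) := hρ.finite_fixedPoints ⟨K₁, hK₁o⟩ hK₁c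
  set T : Submodule ℂ V := W.toSubmodule ⊓ ρ.fixedPoints K₁ with hT
  haveI : FiniteDimensional ℂ T := Submodule.finiteDimensional_inf_right _ _
  haveI : CompleteSpace T := FiniteDimensional.complete ℂ T
  -- `v = t + z`, `t ∈ T ⊆ W`, `z ⊥ T`
  have hvK₁ : v ∈ ρ.fixedPoints K₁ := by
    rw [Representation.mem_fixedPoints]
    intro k hk
    rw [hK₁] at hk
    exact (Representation.mem_stabilizerSubgroup _ _ _).1 hk.2
  set t : V := T.starProjection v with ht
  have htT : t ∈ T := Submodule.starProjection_apply_mem T v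
  have hz : v - t ∈ Tᗮ := Submodule.sub_starProjection_mem_orthogonal v
  have hzK₁ : v - t ∈ ρ.fixedPoints K₁ := Submodule.sub_mem _ hvK₁ htT.2
  -- `z ⊥ W`: `⟨z, w⟩ = ⟨z, e_{K₁} w⟩ = 0`
  have hzW : v - t ∈ W.toSubmoduleᗮ := by
    rw [Submodule.mem_orthogonal']
    intro w hw
    -- linearity of `ip (v - t) ·`
    have h_add_right : ∀ x y y', ip x (y + y') = ip x y + ip x y' := fun x y y' => by
      rw [← h_conj_symm, h_add_left, map_add, h_conj_symm, h_conj_symm]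
    have h_smul_right : ∀ (c : ℂ) (x y : V), ip x (c • y) = c * ip x y := fun c x y => by
      rw [← h_conj_symm, h_smul_left, map_mul, RingHomCompTriple.comp_apply, RingHom.id_apply, h_conj_symm]
    -- `⟨z, ρ k w⟩ = ⟨z, w⟩` for `k ∈ K₁`
    have hzk : ∀ k ∈ K₁, ip (v - t) (ρ k w) = ip (v - t) w := by
      intro k hk
      have hfix : ρ k (v - t) = v - t := (Representation.mem_fixedPoints _ _ _).1 hzK₁ k hk
      conv_lhs => rw [← hfix]
      exact h_inv k _ _
    -- the orbit average
    have hsmooth : ρ.IsSmoothVector w := hρ.isSmooth w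
    have hOfin : (orbitSet ρ K₁ w).Finite := finite_orbitSet hK₁c hsmooth
    have hOne : (orbitSet ρ K₁ w).Nonempty := ⟨w, self_mem_orbitSet⟩
    have havg : ip (v - t) (avg ρ K₁ w) = ip (v - t) w := by
      rw [avg, h_smul_right, finsum_mem_eq_finite_toFinset_sum _ hOfin]
      have hsum : ip (v - t) (∑ y ∈ hOfin.toFinset, y) = ∑ y ∈ hOfin.toFinset, ip (v - t) y := by
        refine Finset.induction_on hOfin.toFinset ?_ ?_
        · rw [Finset.sum_empty, Finset.sum_empty, ← h_conj_symm, ← zero_smul ℂ (0 : V), h_smul_left,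
            map_zero, zero_mul, map_zero]
        · intro a s ha ih
          rw [Finset.sum_insert ha, Finset.sum_insert ha, h_add_right, ih]
      rw [hsum, Finset.sum_congr rfl fun y hy => ?_, Finset.sum_const, nsmul_eq_mul,
        Set.ncard_eq_toFinset_card _ hOfin, ← mul_assoc, inv_mul_cancel₀, one_mul]
      · exact Nat.cast_ne_zero.2 (Finset.card_ne_zero.2 ⟨w, hOfin.mem_toFinset.2 self_mem_orbitSet⟩)
      · obtain ⟨k, hk, rfl⟩ := mem_orbitSet_iff.1 (hOfin.mem_toFinset.1 hy)
        exact hzk k hk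
    have havgT : avg ρ K₁ w ∈ T := ⟨avg_mem_subrepresentation ρ K₁ W hw, avg_mem_fixedPoints hK₁c hsmooth⟩
    have h0 : ip (avg ρ K₁ w) (v - t) = 0 := by
      rw [← hinner]; exact (Submodule.mem_orthogonal T _).1 hz _ havgT
    rw [hinner, ← havg, ← h_conj_symm, h0, map_zero]
  have hv : v = t + (v - t) := by rw [add_sub_cancel]
  rw [hv]
  exact Submodule.add_mem_sup htT.1 hzW

end Literature.NumberTheory.Automorphic

end
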